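import Mathlib
import HarnessLib
import Summits.PneNP.PneNP.Theorems.AeaCutRectanglesTransversalEngine
import Summits.PneNP.PneNP.Theorems.AeaCutRectanglesDutyRectangles

/-!
# Route AeaCutRectangles — crux `FoolingMeasure` (stmt-PneNP-19727): CLASS CUTS OF A D2 WITNESS SPLIT FEW UNITS

A necessary condition on the SPREAD hypothesis of the engine line
(`AeaCutRectanglesFixedCutFooling.foolingMeasure_of_spreadSystem`: every near-balanced cut must split
`(n/2)·log₂ n + C·n` units).  Let `c` be a D2 witness of unit `i₀` — a proper 3-colouring of `Γ − π_{i₀}`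
(`c ∉ killSet (gammaMinus W π i₀)`) — and `X` one of its colour classes.

* `no_inside_edge_of_subset_class` — a cut `B ⊆ X` contains no edge of any unit `i ≠ i₀` (such an edge would be
  monochromatic); hence (`splitUnits_subset_class`) the units split by `B` are among `{i₀}` and
  (`card_splitUnits_le_one_of_subset_class`) `B` splits at most ONE unit.
* `splitUnits_subset_of_class_cut` — for an ARBITRARY cut `B`, every unit `i ≠ i₀` split by `B` contains a vertex
  of `B ∖ X` (so `s(B) ≤ 1 + #units meeting B ∖ X`: the split value is controlled by the part of the cut OUTSIDE
  a witness class).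

Consequence for X1 via the engine: every D2 witness class of a spread system must miss the near-balance window
(a class `X` with `(1/2−ε)n ≤ |X|` yields a near-balanced cut inside `X` with split value `≤ 1`), and more
generally the vertices a near-balanced cut needs beyond a large witness class must carry `(n/2)·log₂ n` unit
incidences (lead prover pnp-aea-p1, NOTES A10a).

HONEST FRAMING: an elementary observation about proper colourings; FRONTIER material for a rung of Fagin's
complement ladder; nothing here bears on P vs NP.
-/

set_option linter.dupNamespace false -- `Summit.PneNP.PneNP.…`: summit = sub-problem name (D-0017 single-conjunct layout)

namespace Summit.PneNP.PneNP.Theorems.AeaCutRectanglesClassCuts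

open Finset
open Summit.PneNP.PneNP.Theorems.AeaCutRectanglesTransversalEngine
open Summit.PneNP.PneNP.Theorems.AeaCutRectanglesDutyRectangles

variable {V ι : Type*} [Fintype V] [DecidableEq V] [Fintype ι] [DecidableEq ι]

/-- The set of units SPLIT by the cut `B`: one edge inside `B`, another meeting `V ∖ B` (the index set of the
engine's `rect_mass_le_half_pow`). -/
def splitUnits (π : ι → Finset (Sym2 V)) (B : Finset V) : Finset ι :=
  univ.filter fun i => (∃ e ∈ π i, ∀ v ∈ e, v ∈ B) ∧ (∃ e ∈ π i, ∃ v ∈ e, v ∉ B)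

omit [Fintype V] [DecidableEq ι] in
/-- Membership in `splitUnits`. -/
theorem mem_splitUnits [Fintype V] {π : ι → Finset (Sym2 V)} {B : Finset V} {i : ι} :
    i ∈ splitUnits π B ↔ (∃ e ∈ π i, ∀ v ∈ e, v ∈ B) ∧ (∃ e ∈ π i, ∃ v ∈ e, v ∉ B) := by
  simp [splitUnits]

omit [Fintype V] [DecidableEq V] [Fintype ι] [DecidableEq ι] in
/-- A non-loop edge whose endpoints all have colour `γ` is monochromatic. -/
theorem map_isDiag_of_forall_eq {c : V → Fin 3} {γ : Fin 3} {e : Sym2 V} (h : ∀ v ∈ e, c v = γ) :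
    (e.map c).IsDiag := by
  induction e using Sym2.ind with
  | h a b =>
    rw [map_mk_isDiag_iff]
    rw [h a (Sym2.mem_mk_left a b), h b (Sym2.mem_mk_right a b)]

omit [Fintype V] in
/-- **No unit edge inside a witness class.**  If `c` properly 3-colours `Γ − π_{i₀}` (a D2 witness of unit `i₀`),
unit edges are loopless and `B` lies inside the colour class `γ` of `c`, then no unit `i ≠ i₀` has an edge
inside `B`. -/
theorem no_inside_edge_of_subset_class {W : Finset (Sym2 V)} {π : ι → Finset (Sym2 V)} {i₀ : ι}
    {c : V → Fin 3} (hc : c ∉ killSet (gammaMinus W π i₀)) (hloop : ∀ i, ∀ e ∈ π i, ¬ e.IsDiag)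
    {γ : Fin 3} {B : Finset V} (hB : ∀ v ∈ B, c v = γ) {i : ι} (hi : i ≠ i₀) :
    ¬ ∃ e ∈ π i, ∀ v ∈ e, v ∈ B := by
  rintro ⟨e, he, hin⟩
  exact hc ⟨e, mem_gammaMinus.2 (Or.inr ⟨i, hi, he⟩), hloop i e he,
    map_isDiag_of_forall_eq fun v hv => hB v (hin v hv)⟩

/-- **A cut inside a witness class splits at most the witnessed unit.** -/
theorem splitUnits_subset_class {W : Finset (Sym2 V)} {π : ι → Finset (Sym2 V)} {i₀ : ι}
    {c : V → Fin 3} (hc : c ∉ killSet (gammaMinus W π i₀)) (hloop : ∀ i, ∀ e ∈ π i, ¬ e.IsDiag)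
    {γ : Fin 3} {B : Finset V} (hB : ∀ v ∈ B, c v = γ) : splitUnits π B ⊆ {i₀} := by
  intro i hi
  rw [mem_singleton]
  by_contra hne
  exact no_inside_edge_of_subset_class hc hloop hB hne (mem_splitUnits.1 hi).1

/-- Hence such a cut has split value at most `1` (the engine bound `(1/2)^{s(B)}` is then `≥ 1/2`: no fooling). -/
theorem card_splitUnits_le_one_of_subset_class {W : Finset (Sym2 V)} {π : ι → Finset (Sym2 V)} {i₀ : ι}
    {c : V → Fin 3} (hc : c ∉ killSet (gammaMinus W π i₀)) (hloop : ∀ i, ∀ e ∈ π i, ¬ e.IsDiag)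
    {γ : Fin 3} {B : Finset V} (hB : ∀ v ∈ B, c v = γ) : (splitUnits π B).card ≤ 1 := by
  calc (splitUnits π B).card ≤ ({i₀} : Finset ι).card := card_le_card (splitUnits_subset_class hc hloop hB)
    _ = 1 := card_singleton i₀

/-- **General cuts: split units live off the witness class.**  For any cut `B` and any colour class `γ` of a D2
witness `c` of unit `i₀`, every split unit `i ≠ i₀` has an edge inside `B` with an endpoint OUTSIDE the class
(i.e. in `B ∖ c⁻¹(γ)`).  So `s(B) ≤ 1 + #{units with a vertex in B ∖ c⁻¹(γ)}`. -/
theorem splitUnits_subset_of_class_cut {W : Finset (Sym2 V)} {π : ι → Finset (Sym2 V)} {i₀ : ι}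
    {c : V → Fin 3} (hc : c ∉ killSet (gammaMinus W π i₀)) (hloop : ∀ i, ∀ e ∈ π i, ¬ e.IsDiag)
    (γ : Fin 3) (B : Finset V) {i : ι} (hi : i ∈ splitUnits π B) (hne : i ≠ i₀) :
    ∃ e ∈ π i, (∀ v ∈ e, v ∈ B) ∧ ∃ v ∈ e, c v ≠ γ := by
  obtain ⟨⟨e, he, hin⟩, -⟩ := mem_splitUnits.1 hi
  refine ⟨e, he, hin, ?_⟩
  by_contra hall
  push Not at hall
  exact hc ⟨e, mem_gammaMinus.2 (Or.inr ⟨i, hne, he⟩), hloop i e he, map_isDiag_of_forall_eq hall⟩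

/-- Counting form: the split units other than `i₀` inject into the units having an edge inside `B` with an
endpoint outside the class `γ`; in particular
`#splitUnits ≤ 1 + #{i | ∃ e ∈ π i, (e ⊆ B) ∧ (e meets B ∖ c⁻¹ γ)}`. -/
theorem card_splitUnits_le {W : Finset (Sym2 V)} {π : ι → Finset (Sym2 V)} {i₀ : ι}
    {c : V → Fin 3} (hc : c ∉ killSet (gammaMinus W π i₀)) (hloop : ∀ i, ∀ e ∈ π i, ¬ e.IsDiag)
    (γ : Fin 3) (B : Finset V) :
    (splitUnits π B).card ≤
      1 + (univ.filter fun i => ∃ e ∈ π i, (∀ v ∈ e, v ∈ B) ∧ ∃ v ∈ e, c v ≠ γ).card := by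
  classical
  have hsub : splitUnits π B ⊆
      insert i₀ (univ.filter fun i => ∃ e ∈ π i, (∀ v ∈ e, v ∈ B) ∧ ∃ v ∈ e, c v ≠ γ) := by
    intro i hi
    rw [mem_insert]
    by_cases h : i = i₀
    · exact Or.inl h
    · exact Or.inr (mem_filter.2 ⟨mem_univ _, splitUnits_subset_of_class_cut hc hloop γ B hi h⟩)
  exact (card_le_card hsub).trans ((card_insert_le _ _).trans (by omega))

end Summit.PneNP.PneNP.Theorems.AeaCutRectanglesClassCuts
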